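import Mathlib
import HarnessLib

/-!
# `BetaCancellation` (stmt-KontsevichZagierPeriods-13633) — line `dirichlet-companion-to-pi`,
stub `stub_eulerPartialFractions`

The REAL partial-fraction expansion of the rational integrand produced by the rationalising
substitution in the one-dimensional proof of Euler's reflection formula:
for `0 < p < q` and every real `s`,

`q (s^{p-1} + s^{q-p-1}) = (1 + s^q) · Σ_{j < q/2} 4 sin(p θ_j) sin θ_j / (s² − 2 cos θ_j s + 1)`,
`θ_j = (2j+1)π/q`.

Proof (elementary, over `ℂ`): with `ζ_j = exp(i θ_j)` (`j < q`, the roots of `s^q + 1`) and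
`η = exp(2πi/q)` one has `ζ_j^m = exp(iπm/q) η^{jm}` and `Σ_{j<q} η^{jm} = q·[q ∣ m]`, whence the
denominator-free key identity `Σ_j ζ_j^{k+1} Σ_{i<q} s^i ζ_j^{q-1-i} = −q s^k` (`k < q`); since
`(Σ_{i<q} s^i ζ_j^{q-1-i})(s − ζ_j) = s^q + 1` this gives, for `s^q + 1 ≠ 0`,
`(s^q+1) Σ_j ζ_j^{k+1}/(s − ζ_j) = −q s^k`. Adding the cases `k = p − 1`, `k = q − p − 1` and using
`ζ_j^p + ζ_j^{q-p} = 2 i sin(p θ_j)`, then taking real parts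
(`Re[2ia/(s − e^{iθ})] = −2a sin θ/(s² − 2 cos θ s + 1)` for real `s`) yields the sum over all
`j < q`; the terms `j` and `q − 1 − j` agree and the middle term (odd `q`, `θ = π`) vanishes, which
folds the sum onto `j < q/2`. The degenerate case `1 + s^q = 0` (`s = −1`, `q` odd) is checked
directly. Pure proof file (no definitions).
-/

noncomputable section

-- `Summit.KontsevichZagierPeriods.KontsevichZagierPeriods.…` is the tree's mandated layout (single-conjunct summit).
set_option linter.dupNamespace false

namespace Summit.KontsevichZagierPeriods.KontsevichZagierPeriods.BetaCancellationLine

open Finset Complex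

/-- Character sum of the `q`-th roots of unity: `Σ_{j<q} η^{jm} = q` if `q ∣ m`, else `0`
(`η = exp(2πi/q)`). [folklore] -/
theorem eulerPF_sum_primRoot_pow (q m : ℕ) (hq : q ≠ 0) :
    ∑ j ∈ range q, Complex.exp (2 * Real.pi * I / q) ^ (j * m) =
      if q ∣ m then (q : ℂ) else 0 := by
  have hprim := Complex.isPrimitiveRoot_exp q hq
  have h1 : ∀ j : ℕ, Complex.exp (2 * Real.pi * I / q) ^ (j * m) =
      (Complex.exp (2 * Real.pi * I / q) ^ m) ^ j := fun j => pow_mul' _ j m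
  simp_rw [h1]
  split_ifs with hd
  · rw [(hprim.pow_eq_one_iff_dvd m).2 hd]
    simp
  · have hne : Complex.exp (2 * Real.pi * I / q) ^ m ≠ 1 := fun h =>
      hd ((hprim.pow_eq_one_iff_dvd m).1 h)
    rw [geom_sum_eq hne, ← pow_mul, mul_comm m q, pow_mul, hprim.pow_eq_one, one_pow, sub_self,
      zero_div]

/-- `ζ_j^m = exp(iπm/q) · η^{jm}` for `ζ_j = exp(iπ(2j+1)/q)`, `η = exp(2πi/q)`. [folklore] -/
theorem eulerPF_zeta_pow (q j m : ℕ) (hq : q ≠ 0) :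
    Complex.exp (((Real.pi * (2 * j + 1) / q : ℝ) : ℂ) * I) ^ m =
      Complex.exp ((Real.pi : ℂ) * m / q * I) * Complex.exp (2 * Real.pi * I / q) ^ (j * m) := by
  rw [← Complex.exp_nat_mul, ← Complex.exp_nat_mul, ← Complex.exp_add]
  congr 1
  have hq' : (q : ℂ) ≠ 0 := Nat.cast_ne_zero.2 hq
  push_cast
  field_simp
  ring

/-- `ζ_j^q = -1` for `ζ_j = exp(iπ(2j+1)/q)`. [folklore] -/
theorem eulerPF_zeta_pow_self (q j : ℕ) (hq : q ≠ 0) :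
    Complex.exp (((Real.pi * (2 * j + 1) / q : ℝ) : ℂ) * I) ^ q = -1 := by
  rw [← Complex.exp_nat_mul]
  have hq' : (q : ℂ) ≠ 0 := Nat.cast_ne_zero.2 hq
  have : (q : ℂ) * (((Real.pi * (2 * j + 1) / q : ℝ) : ℂ) * I) =
      ((2 * j + 1 : ℕ) : ℂ) * (Real.pi * I) := by
    push_cast
    field_simp
  rw [this, Complex.exp_nat_mul, Complex.exp_pi_mul_I, pow_succ, pow_mul]
  norm_num

/-- Power sums of the roots of `s^q + 1`: for `0 < m < 2q`, `Σ_{j<q} ζ_j^m = -q` if `m = q` and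
`0` otherwise. [folklore] -/
theorem eulerPF_sum_zeta_pow (q m : ℕ) (hq : q ≠ 0) (hm0 : 0 < m) (hm : m < 2 * q) :
    ∑ j ∈ range q, Complex.exp (((Real.pi * (2 * j + 1) / q : ℝ) : ℂ) * I) ^ m =
      if m = q then -(q : ℂ) else 0 := by
  simp_rw [eulerPF_zeta_pow q _ m hq, ← Finset.mul_sum, eulerPF_sum_primRoot_pow q m hq]
  by_cases hmq : m = q
  · have hd : q ∣ m := ⟨1, by rw [hmq, mul_one]⟩
    rw [if_pos hd, if_pos hmq, hmq, mul_div_assoc, div_self (Nat.cast_ne_zero.2 hq), mul_one,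
      Complex.exp_pi_mul_I]
    ring
  · have hnd : ¬ q ∣ m := by
      rintro ⟨c, rfl⟩
      rcases Nat.lt_or_ge c 2 with hc | hc
      · interval_cases c
        · simp at hm0
        · simp at hmq
      · have : q * 2 ≤ q * c := Nat.mul_le_mul_left q hc
        omega
    rw [if_neg hnd, if_neg hmq, mul_zero]

/-- The denominator-free key identity: for `k < q` and every `s : ℂ`,
`Σ_{j<q} ζ_j^{k+1} · Σ_{i<q} s^i ζ_j^{q-1-i} = -q s^k`. [folklore] -/
theorem eulerPF_key (q k : ℕ) (hq : q ≠ 0) (hk : k < q) (s : ℂ) :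
    ∑ j ∈ range q, Complex.exp (((Real.pi * (2 * j + 1) / q : ℝ) : ℂ) * I) ^ (k + 1) *
        ∑ i ∈ range q, s ^ i *
          Complex.exp (((Real.pi * (2 * j + 1) / q : ℝ) : ℂ) * I) ^ (q - 1 - i) =
      -(q : ℂ) * s ^ k := by
  have h1 : ∀ j ∈ range q,
      Complex.exp (((Real.pi * (2 * j + 1) / q : ℝ) : ℂ) * I) ^ (k + 1) *
        ∑ i ∈ range q, s ^ i *
          Complex.exp (((Real.pi * (2 * j + 1) / q : ℝ) : ℂ) * I) ^ (q - 1 - i) =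
      ∑ i ∈ range q, s ^ i *
          Complex.exp (((Real.pi * (2 * j + 1) / q : ℝ) : ℂ) * I) ^ (k + q - i) := by
    intro j _
    rw [Finset.mul_sum]
    refine Finset.sum_congr rfl fun i hi => ?_
    have hi' := Finset.mem_range.1 hi
    rw [mul_left_comm, ← pow_add]
    congr 3
    omega
  rw [Finset.sum_congr rfl h1, Finset.sum_comm]
  simp_rw [← Finset.mul_sum]
  rw [Finset.sum_eq_single k]
  · rw [eulerPF_sum_zeta_pow q (k + q - k) hq (by omega) (by omega), if_pos (by omega)]
    ring
  · intro i hi hik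
    have hi' := Finset.mem_range.1 hi
    rw [eulerPF_sum_zeta_pow q (k + q - i) hq (by omega) (by omega), if_neg (by omega), mul_zero]
  · intro hk'
    exact absurd (Finset.mem_range.2 hk) hk'

/-- The key identity with denominators: for `k < q` and `s : ℂ` with `s^q + 1 ≠ 0`,
`(s^q + 1) Σ_{j<q} ζ_j^{k+1}/(s − ζ_j) = -q s^k`. [folklore] -/
theorem eulerPF_key_div (q k : ℕ) (hq : q ≠ 0) (hk : k < q) (s : ℂ) (hs : s ^ q + 1 ≠ 0) :
    (s ^ q + 1) * ∑ j ∈ range q,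
        Complex.exp (((Real.pi * (2 * j + 1) / q : ℝ) : ℂ) * I) ^ (k + 1) /
          (s - Complex.exp (((Real.pi * (2 * j + 1) / q : ℝ) : ℂ) * I)) = -(q : ℂ) * s ^ k := by
  rw [← eulerPF_key q k hq hk s, Finset.mul_sum]
  refine Finset.sum_congr rfl fun j _ => ?_
  have hG := geom_sum₂_mul s (Complex.exp (((Real.pi * (2 * j + 1) / q : ℝ) : ℂ) * I)) q
  rw [eulerPF_zeta_pow_self q j hq, sub_neg_eq_add] at hG
  have hne : s - Complex.exp (((Real.pi * (2 * j + 1) / q : ℝ) : ℂ) * I) ≠ 0 := by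
    intro h
    rw [h, mul_zero] at hG
    exact hs hG.symm
  rw [← hG]
  field_simp

/-- `ζ_j^p + ζ_j^{q-p} = 2 i sin(p θ_j)` for `p ≤ q`, `ζ_j = exp(i θ_j)`, `θ_j = (2j+1)π/q`.
[folklore] -/
theorem eulerPF_zeta_pow_add (p q j : ℕ) (hq : q ≠ 0) (hpq : p ≤ q) :
    Complex.exp (((Real.pi * (2 * j + 1) / q : ℝ) : ℂ) * I) ^ p +
        Complex.exp (((Real.pi * (2 * j + 1) / q : ℝ) : ℂ) * I) ^ (q - p) =
      2 * ((Real.sin (Real.pi * (2 * j + 1) * p / q) : ℝ) : ℂ) * I := by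
  have hq' := eulerPF_zeta_pow_self q j hq
  have hp : Complex.exp (((Real.pi * (2 * j + 1) / q : ℝ) : ℂ) * I) ^ p =
      Complex.exp (((Real.pi * (2 * j + 1) * p / q : ℝ) : ℂ) * I) := by
    rw [← Complex.exp_nat_mul]
    congr 1
    push_cast
    ring
  have hqp : Complex.exp (((Real.pi * (2 * j + 1) / q : ℝ) : ℂ) * I) ^ (q - p) =
      -Complex.exp (-(((Real.pi * (2 * j + 1) * p / q : ℝ) : ℂ) * I)) := by
    have h1 : Complex.exp (((Real.pi * (2 * j + 1) / q : ℝ) : ℂ) * I) ^ (q - p) *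
        Complex.exp (((Real.pi * (2 * j + 1) / q : ℝ) : ℂ) * I) ^ p = -1 := by
      rw [← pow_add, Nat.sub_add_cancel hpq, hq']
    rw [hp] at h1
    rw [Complex.exp_neg, eq_div_of_mul_eq (Complex.exp_ne_zero _) h1, neg_div, one_div]
  rw [hp, hqp, Complex.ofReal_sin]
  have h2 := Complex.two_sin (((Real.pi * (2 * j + 1) * p / q : ℝ) : ℂ))
  rw [neg_mul] at h2
  calc Complex.exp (((Real.pi * (2 * j + 1) * p / q : ℝ) : ℂ) * I) +
        -Complex.exp (-(((Real.pi * (2 * j + 1) * p / q : ℝ) : ℂ) * I))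
      = ((Complex.exp (-(((Real.pi * (2 * j + 1) * p / q : ℝ) : ℂ) * I)) -
          Complex.exp (((Real.pi * (2 * j + 1) * p / q : ℝ) : ℂ) * I)) * I) * I := by
        linear_combination (Complex.exp (((Real.pi * (2 * j + 1) * p / q : ℝ) : ℂ) * I) -
          Complex.exp (-(((Real.pi * (2 * j + 1) * p / q : ℝ) : ℂ) * I))) * Complex.I_mul_I
    _ = 2 * Complex.sin (((Real.pi * (2 * j + 1) * p / q : ℝ) : ℂ)) * I := by rw [← h2]

/-- Real part of one complex partial fraction at a real point:
`Re[2ia/(s − e^{iθ})] = −2a sin θ/(s² − 2 cos θ s + 1)`. [folklore] -/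
theorem eulerPF_re_term (a θ s : ℝ) :
    (2 * (a : ℂ) * I / ((s : ℂ) - Complex.exp ((θ : ℂ) * I))).re =
      -(2 * a * Real.sin θ / (s ^ 2 - 2 * Real.cos θ * s + 1)) := by
  have hre : ((s : ℂ) - Complex.exp ((θ : ℂ) * I)).re = s - Real.cos θ := by
    simp [Complex.exp_ofReal_mul_I_re]
  have him : ((s : ℂ) - Complex.exp ((θ : ℂ) * I)).im = -Real.sin θ := by
    simp [Complex.exp_ofReal_mul_I_im]
  have hre' : (2 * (a : ℂ) * I).re = 0 := by simp
  have him' : (2 * (a : ℂ) * I).im = 2 * a := by simp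
  have hN : Complex.normSq ((s : ℂ) - Complex.exp ((θ : ℂ) * I)) =
      s ^ 2 - 2 * Real.cos θ * s + 1 := by
    rw [Complex.normSq_apply, hre, him]
    linear_combination Real.sin_sq_add_cos_sq θ
  rw [Complex.div_re, hN, hre, him, hre', him']
  ring

/-- Folding a sum over `j < q` whose terms are symmetric under `j ↦ q − 1 − j` and whose middle
term (odd `q`) vanishes onto `j < q/2`. [folklore] -/
theorem eulerPF_fold (q : ℕ) (F : ℕ → ℝ) (hsymm : ∀ j < q, F (q - 1 - j) = F j)
    (hmid : ∀ j, 2 * j + 1 = q → F j = 0) :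
    ∑ j ∈ range q, F j = ∑ j ∈ range (q / 2), 2 * F j := by
  obtain ⟨m, rfl | rfl⟩ := Nat.even_or_odd' q
  · have h2 : 2 * m / 2 = m := by omega
    rw [h2, two_mul m, Finset.sum_range_add]
    have hrefl : ∑ j ∈ range m, F (m + j) = ∑ j ∈ range m, F j := by
      rw [← Finset.sum_range_reflect (fun j => F (m + j)) m]
      refine Finset.sum_congr rfl fun j hj => ?_
      have hj' := Finset.mem_range.1 hj
      have := hsymm j (by omega)
      rwa [show 2 * m - 1 - j = m + (m - 1 - j) by omega] at this
    rw [hrefl, ← two_mul, Finset.mul_sum]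
  · have h2 : (2 * m + 1) / 2 = m := by omega
    rw [h2, show 2 * m + 1 = m + (m + 1) by ring, Finset.sum_range_add, Finset.sum_range_succ',
      add_zero, hmid m (by ring), add_zero]
    have hrefl : ∑ j ∈ range m, F (m + (j + 1)) = ∑ j ∈ range m, F j := by
      rw [← Finset.sum_range_reflect (fun j => F (m + (j + 1))) m]
      refine Finset.sum_congr rfl fun j hj => ?_
      have hj' := Finset.mem_range.1 hj
      have := hsymm j (by omega)
      rwa [show 2 * m + 1 - 1 - j = m + (m - 1 - j + 1) by omega] at this
    rw [hrefl, ← two_mul, Finset.mul_sum]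

/-- The symmetry `j ↦ q − 1 − j` of the real partial fractions (`θ ↦ 2π − θ`). [folklore] -/
theorem eulerPF_term_symm (p q j : ℕ) (hj : j < q) (s : ℝ) :
    2 * Real.sin (Real.pi * (2 * ((q - 1 - j : ℕ) : ℝ) + 1) * p / q) *
        Real.sin (Real.pi * (2 * ((q - 1 - j : ℕ) : ℝ) + 1) / q) /
        (s ^ 2 - 2 * Real.cos (Real.pi * (2 * ((q - 1 - j : ℕ) : ℝ) + 1) / q) * s + 1) =
      2 * Real.sin (Real.pi * (2 * j + 1) * p / q) * Real.sin (Real.pi * (2 * j + 1) / q) /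
        (s ^ 2 - 2 * Real.cos (Real.pi * (2 * j + 1) / q) * s + 1) := by
  have hq : (q : ℝ) ≠ 0 := by
    have : 0 < q := by omega
    positivity
  have hcast : ((q - 1 - j : ℕ) : ℝ) = (q : ℝ) - 1 - j := by
    rw [Nat.sub_sub, Nat.cast_sub (by omega)]
    push_cast
    ring
  have hA : Real.pi * (2 * ((q : ℝ) - 1 - j) + 1) * p / q =
      -(Real.pi * (2 * j + 1) * p / q) + p * (2 * Real.pi) := by
    field_simp
    ring
  have hB : Real.pi * (2 * ((q : ℝ) - 1 - j) + 1) / q =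
      -(Real.pi * (2 * j + 1) / q) + 2 * Real.pi := by
    field_simp
    ring
  rw [hcast, hA, hB, Real.sin_add_nat_mul_two_pi, Real.sin_add_two_pi, Real.cos_add_two_pi,
    Real.sin_neg, Real.sin_neg, Real.cos_neg]
  ring

/-- STUB `stub_eulerPartialFractions`: the real partial-fraction expansion of
`q(s^{p-1}+s^{q-p-1})/(1+s^q)` over the pairs of complex-conjugate roots of `s^q + 1`
(`θ_j = (2j+1)π/q`, `j < q/2`; the real root `−1`, present for odd `q`, has residue `0`),
in the polynomial form valid for every real `s`. [folklore] -/
theorem stub_eulerPartialFractions : ∀ (p q : ℕ), 0 < p → p < q → ∀ s : ℝ,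
    (q:ℝ) * (s ^ (p - 1) + s ^ (q - p - 1)) =
      (1 + s ^ q) * ∑ j ∈ Finset.range (q / 2),
        4 * Real.sin (Real.pi * (2 * j + 1) * p / q) * Real.sin (Real.pi * (2 * j + 1) / q) /
          (s ^ 2 - 2 * Real.cos (Real.pi * (2 * j + 1) / q) * s + 1) := by
  intro p q hp hpq s
  have hq : q ≠ 0 := by omega
  rcases eq_or_ne (1 + s ^ q) 0 with h0 | h0
  · -- degenerate case: `s = -1`, `q` odd
    rw [h0, zero_mul]
    have hsq : s ^ q = -1 := by linarith
    have hodd : Odd q := by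
      rcases Nat.even_or_odd q with he | ho
      · have := he.pow_nonneg s
        linarith
      · exact ho
    have hs1 : s = -1 := by
      have habs : |s| ^ q = 1 := by rw [pow_abs, hsq]; simp
      have habs1 : |s| = 1 := (pow_eq_one_iff_of_nonneg (abs_nonneg s) hq).1 habs
      rcases (abs_eq zero_le_one).1 habs1 with h1 | h1
      · rw [h1, one_pow] at hsq
        norm_num at hsq
      · exact h1
    subst hs1
    have hprod : (-1 : ℝ) ^ (p - 1) * (-1) ^ (q - p - 1) = -1 := by
      have h : (-1 : ℝ) ^ q = -1 := hodd.neg_one_pow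
      rw [← pow_add, show p - 1 + (q - p - 1) = q - 2 by omega]
      rw [show q = q - 2 + 2 by omega, pow_add] at h
      linear_combination h
    have hsq1 : (-1 : ℝ) ^ (p - 1) * (-1) ^ (p - 1) = 1 := by
      rw [← pow_add, ← two_mul]
      exact (even_two_mul _).neg_one_pow
    have hsum : (-1 : ℝ) ^ (p - 1) + (-1) ^ (q - p - 1) = 0 := by
      linear_combination (-((-1 : ℝ) ^ (q - p - 1))) * hsq1 + ((-1 : ℝ) ^ (p - 1)) * hprod
    rw [hsum, mul_zero]
  · -- main case: `1 + s^q ≠ 0`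
    have hs' : (s : ℂ) ^ q + 1 ≠ 0 := by
      rw [add_comm]
      exact_mod_cast h0
    have h1 := eulerPF_key_div q (p - 1) hq (by omega) (s : ℂ) hs'
    have h2 := eulerPF_key_div q (q - p - 1) hq (by omega) (s : ℂ) hs'
    rw [Nat.sub_add_cancel hp] at h1
    rw [show q - p - 1 + 1 = q - p by omega] at h2
    have hsum : ∑ j ∈ range q,
          Complex.exp (((Real.pi * (2 * j + 1) / q : ℝ) : ℂ) * I) ^ p /
            ((s : ℂ) - Complex.exp (((Real.pi * (2 * j + 1) / q : ℝ) : ℂ) * I)) +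
        ∑ j ∈ range q,
          Complex.exp (((Real.pi * (2 * j + 1) / q : ℝ) : ℂ) * I) ^ (q - p) /
            ((s : ℂ) - Complex.exp (((Real.pi * (2 * j + 1) / q : ℝ) : ℂ) * I)) =
        ∑ j ∈ range q, 2 * ((Real.sin (Real.pi * (2 * j + 1) * p / q) : ℝ) : ℂ) * I /
            ((s : ℂ) - Complex.exp (((Real.pi * (2 * j + 1) / q : ℝ) : ℂ) * I)) := by
      rw [← Finset.sum_add_distrib]
      refine Finset.sum_congr rfl fun j _ => ?_
      rw [← add_div, eulerPF_zeta_pow_add p q j hq hpq.le]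
    have hC : (q : ℂ) * ((s : ℂ) ^ (p - 1) + (s : ℂ) ^ (q - p - 1)) =
        -(((s : ℂ) ^ q + 1) * ∑ j ∈ range q,
          2 * ((Real.sin (Real.pi * (2 * j + 1) * p / q) : ℝ) : ℂ) * I /
            ((s : ℂ) - Complex.exp (((Real.pi * (2 * j + 1) / q : ℝ) : ℂ) * I))) := by
      rw [← hsum, mul_add ((s : ℂ) ^ q + 1), h1, h2]
      ring
    have eL : ((q : ℂ) * ((s : ℂ) ^ (p - 1) + (s : ℂ) ^ (q - p - 1))).re =
        (q : ℝ) * (s ^ (p - 1) + s ^ (q - p - 1)) := by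
      have : (q : ℂ) * ((s : ℂ) ^ (p - 1) + (s : ℂ) ^ (q - p - 1)) =
          (((q : ℝ) * (s ^ (p - 1) + s ^ (q - p - 1)) : ℝ) : ℂ) := by push_cast; ring
      rw [this, Complex.ofReal_re]
    have eX : ((s : ℂ) ^ q + 1) = (((1 + s ^ q : ℝ)) : ℂ) := by push_cast; ring
    have hre := congrArg Complex.re hC
    rw [eL, Complex.neg_re, eX, Complex.re_ofReal_mul, Complex.re_sum] at hre
    simp_rw [eulerPF_re_term] at hre
    rw [Finset.sum_neg_distrib, mul_neg, neg_neg] at hre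
    rw [hre, eulerPF_fold q (fun j => 2 * Real.sin (Real.pi * (2 * j + 1) * p / q) *
      Real.sin (Real.pi * (2 * j + 1) / q) /
        (s ^ 2 - 2 * Real.cos (Real.pi * (2 * j + 1) / q) * s + 1))
      (fun j hj => eulerPF_term_symm p q j hj s) ?_]
    · congr 1
      refine Finset.sum_congr rfl fun j _ => ?_
      ring
    · intro j hj
      have hjq : (2 * (j : ℝ) + 1) = q := by exact_mod_cast hj
      have : Real.pi * (2 * (j : ℝ) + 1) / q = Real.pi := by
        rw [hjq, mul_div_assoc, div_self (by exact_mod_cast hq), mul_one]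
      simp only [this, Real.sin_pi, mul_zero, zero_div]

end Summit.KontsevichZagierPeriods.KontsevichZagierPeriods.BetaCancellationLine
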